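import Literature.AlgebraicGeometry.ModuliOfAbelianVarieties.SiegelFamilyHodgeCircleLocusCMFields
import Literature.AlgebraicGeometry.ModuliOfAbelianVarieties.SiegelFamilyProductLociPicardNumberFormula
import Literature.Geometry.Kaehler.ComplexTorusHodgeGroupHodgeCircleProductsHodgeClasses
import Literature.Geometry.Kaehler.ComplexTorusDivisorClassesIsogeny
import HarnessLib

/-!
# Picard numbers and Hodge classes on `𝔥_{g₁}(K₁) × 𝔥_{g₂}(K₂)`: `D• = H•_Hodge` at every block-diagonal point with
# both blocks on the Hodge-circle locus; `ρ(X_{(Z₁ 0; 0 Z₂)}) = g₁² + g₂² + [K₁ = K₂]·2g₁g₂`;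
# `dim H^{2p}_Hodge = Σ_{a+b=p} C(g₁,a)² C(g₂,b)²` for different fields, `C(g₁+g₂,p)²` for equal fields; the Hodge ring of
# `X_{Z₁}^N × X_{Z₂}^N` is generated by the classes of the factors iff `K₁ ≠ K₂`
# (Moonen–Zarhin 1999 §3 (3.1), Theorem, Corollary; Hulek–Laface 2019 Prop. 2.2 / Cor. 2.3; Beauville 2014 §4;
# Lange 2023 §2.6.3 Exercise (2), §7.3.3 Exercise (3))

Layer `Literature/AlgebraicGeometry/ModuliOfAbelianVarieties`, namespace
`Literature.AlgebraicGeometry.ModuliOfAbelianVarieties.SiegelModuli`; lane `lit-hodgefound` (Track 2 foundations library,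
Layer A4 «Siegel family; special loci»), prover seat p17, generation 32, self-proposed row g32-#7 — the moduli reading of
g32-#6 (`ComplexTorusHodgeGroupHodgeCircleProductsHodgeClasses`: for two tori on the Hodge-circle locus `D• = H•_Hodge` on
`X₁ × X₂` and on all `X₁^{n₁} × X₂^{n₂}`; cross-generated iff `Hom = 0`; dimension formulas) on g32-#5's
`𝔥_{g₁}(K₁) × 𝔥_{g₂}(K₂)` (`SiegelFamilyHodgeCircleLocusCMFields`: `Hom(X_{Z₁}, X_{Z₂}) ≠ 0` ⟺ `K₁ = K₂`), through the
tree's `X_{(Z₁ 0; 0 Z₂)} ≅ X_{Z₁} × X_{Z₂}` (p11 `isIsogenous_prinPeriod_blockDiagPoint_prod`), the isogeny invariance of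
`D = B` and of `dim H^{2p}_Hodge` (`ComplexTorusDivisorClassesIsogeny`), and Hulek–Laface on the product locus (this seat's
g30-#5 `finrank_neronSeveriGroup_prinPeriod_blockDiagPoint`).  THEOREMS ONLY (D-0026, net debt 0).

## Sources, verbatim

* B. Moonen, Yu. Zarhin (1999) (held `paper:arxiv-math_9901113`), §1 (D) (p0004 L58–L66), §3 (3.1) (p0006 L53–L62), §3
  Theorem (p0006 L70–L77: «`X₁ × X₂` again satisfies (D), and either `Hom(X₁, X₂) ≠ 0` or `Hg(X₁ × X₂) = Hg(X₁) × Hg(X₂)`»),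
  §3 Corollary (p0007 L80–L85: «every product of elliptic curves satisfies condition (D)»).
* K. Hulek, R. Laface, *On the Picard numbers of abelian varieties* (2019), §2.1 Prop. 2.2 / Cor. 2.3
  (`ρ(A₁ × A₂) = ρ(A₁) + ρ(A₂) + rk Hom(A₁, A₂)`; additive when `Hom = 0`).
* A. Beauville (2014), §4 Prop. 5 and Lemma 1 (`rk Hom(A, B) ≤ 2ab`, equality iff `A ∼ E^a`, `B ∼ E^b`, `E` CM).
* H. Lange (2023), §2.6.3 Exercise (2) (`𝔥_g(K)`), §7.3.3 Exercise (1)(a),(b) (isogeny invariance), (3)(a),(b) (`X ∼ E^n` CM).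
* H. Imai (1976), §2 Proposition, §3 Remarks and (ii); J. Silverman (1994), II Exercise 2.3.

## What is proved (`[Kᵢ : ℚ] = 2`, `Zᵢ ∈ 𝔥_{gᵢ}(Kᵢ)`, `gᵢ ≥ 1`, `e : Fin g₁ ⊕ Fin g₂ ≃ Fin g`)

* §1 **`D^p = H^{2p}_Hodge` AT EVERY BLOCK-DIAGONAL POINT `(Z₁ 0; 0 Z₂)` WITH BOTH BLOCKS ON THE HODGE-CIRCLE LOCUS**, all `p`
  (`divisorClasses_prinPeriod_blockDiagPoint_eq_hodgeClasses_of_coe_eq_range`), in particular on `𝔥_{g₁}(K₁) × 𝔥_{g₂}(K₂)`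
  (`…_of_mem_siegelPointsIn`): every Hodge class of `X_{(Z₁ 0; 0 Z₂)}` is a polynomial in divisor classes.
* §2 **PICARD NUMBERS AND DIMENSIONS BY THE PAIR OF FIELDS**: `ρ(X_{(Z₁ 0; 0 Z₂)}) = g₁² + g₂²` for `K₁ ≠ K₂` and
  `= (g₁ + g₂)²` for `K₁ = K₂` (`finrank_neronSeveriGroup_prinPeriod_blockDiagPoint_of_quadraticField_ne/eq`, the `ite` form
  `…_eq_ite`); `rk Hom(X_{Z₁}, X_{Z₂}) = 2g₁g₂` or `0` (`finrank_homRat_prinPeriod_eq_ite`); `dim_ℚ H^{2p}_Hodge(X_{(Z₁ 0; 0 Z₂)}) =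
  Σ_{a+b=p} C(g₁,a)² C(g₂,b)²` for `K₁ ≠ K₂`, `= C(g₁+g₂,p)²` for `K₁ = K₂`
  (`finrank_hodgeClasses_prinPeriod_blockDiagPoint_of_quadraticField_ne/eq`).
* §3 **THE HODGE RING OF `X_{Z₁}^N × X_{Z₂}^N` IS GENERATED BY THE CLASSES COMING FROM THE FACTORS (every `N ≥ 1`) ⟺
  `K₁ ≠ K₂`**; exceptional classes on some power ⟺ `K₁ = K₂`; `D = B` on all `X_{Z₁}^{n₁} × X_{Z₂}^{n₂}` either way
  (`forall_hodgeClasses_prodPeriod_powPeriod_prinPeriod_eq_crossSpan_iff_quadraticField_ne`,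
  `exists_hodgeClasses_prodPeriod_powPeriod_prinPeriod_ne_crossSpan_iff_quadraticField_eq`,
  `divisorClasses_prodPeriod_powPeriod_prinPeriod_eq_hodgeClasses_of_mem_siegelPointsIn`).
* §4 **`𝔥₁ × 𝔥₁`**: CM points `τ₁ ∈ K₁`, `τ₂ ∈ K₂`: `ρ(X_{(τ₁ 0; 0 τ₂)}) = 2` for `K₁ ≠ K₂`, `= 4` for `K₁ = K₂` (the field form of
  the tree's `finrank_neronSeveriGroup_blockDiagPoint_eq_two_iff / _eq_four_iff` on `SiegelFamilyProductLociPicardNumbers`).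

## References

* [MoonenZarhin1999LowDim] B. Moonen, Yu. Zarhin, Math. Ann. 315 (1999), §1 (D), §3 (3.1), Theorem, Corollary.
  [cite: MoonenZarhin1999LowDim, §1 (D) (p0004 L58–L66), §3 (3.1) (p0006 L53–L62), §3 Theorem (p0006 L70–L77), §3 Corollary (p0007 L80–L85)]
* [HulekLaface2019PicardNumbersAV] K. Hulek, R. Laface, Ann. Sc. Norm. Super. Pisa (2019), §2.1 Prop. 2.2, Cor. 2.3.
  [cite: HulekLaface2019PicardNumbersAV, §2.1 Prop. 2.2 and Cor. 2.3]
* [Beauville2014MaximalPicard] A. Beauville (2014), §3 Prop. 3, §4 Prop. 5 and Lemma 1. [cite: Beauville2014MaximalPicard, §4 Prop. 5 and Lemma 1]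
* [Lange2023AbelianVarietiesComplex] H. Lange (2023), §2.6.3 Exercise (2), §7.3.3 Exercises (1), (3).
  [cite: Lange2023AbelianVarietiesComplex, §2.6.3 Exercise (2) (iii) and §7.3.3 Exercises (1)(a),(b), (3)(a),(b)]
* [Imai1976HodgeGroups] H. Imai (1976), §2 Proposition, §3 Remarks, (ii). [cite: Imai1976HodgeGroups, §2 Proposition (p. 368) and §3 (ii) (p. 371)]
* [Silverman1994] J. Silverman (1994), Ch. II Exercise 2.3. [cite: Silverman1994, Ch. II Exercise 2.3 (PDF p. 174)]
-/

noncomputable section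

open scoped Matrix Classical
open Matrix Function Set Module Finset

namespace Literature.AlgebraicGeometry.ModuliOfAbelianVarieties

namespace SiegelModuli

open Literature.NumberTheory.Automorphic
open Literature.NumberTheory.ModularForms Literature.NumberTheory.ModularForms.SiegelUpperHalfSpace
open Literature.NumberTheory.ComplexMultiplication Literature.NumberTheory.ComplexMultiplication.SiegelCMPoint
open Literature.Geometry.Kaehler Literature.Geometry.Kaehler.ComplexTorus

variable {g : ℕ}

/-- `dim_ℂ ℂⁿ = n`. [folklore] -/
private theorem finrank_fin_fun_complex₆ (n : ℕ) : finrank ℂ (Fin n → ℂ) = n := Module.finrank_fin_fun ℂ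

/-- `0 < n` ⟹ `0 < dim_ℂ ℂⁿ`. [folklore] -/
private theorem finrank_fin_fun_complex_pos₆ {n : ℕ} (hn : 0 < n) : 0 < finrank ℂ (Fin n → ℂ) := by
  rw [finrank_fin_fun_complex₆]; exact hn

/-! ## §1 `D = B` at every block-diagonal point with both blocks on the Hodge-circle locus -/

section DivisorClasses

variable {g₁ g₂ : ℕ} (e : Fin g₁ ⊕ Fin g₂ ≃ Fin g) {Z₁ : siegelUpperHalfSpace g₁} {Z₂ : siegelUpperHalfSpace g₂}

/-- **`D^p(X_{(Z₁ 0; 0 Z₂)}) = H^{2p}_Hodge(X_{(Z₁ 0; 0 Z₂)})` FOR EVERY `p` WHEN BOTH BLOCKS ARE ON THE HODGE-CIRCLE LOCUS**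
(`g₁, g₂ ≥ 1`; both branches of the dichotomy): g32-#6's `D• = H•_Hodge` on `X_{Z₁} × X_{Z₂}` moved along
`X_{(Z₁ 0; 0 Z₂)} ≅ X_{Z₁} × X_{Z₂}` by Lange's Exercise 7.3.3 (1)(b) (`D = B` is an isogeny invariant).
[cite: MoonenZarhin1999LowDim, §3 Theorem (p0006 L70–L77) and Corollary (p0007 L80–L85)]
[cite: Lange2023AbelianVarietiesComplex, §7.3.3 Exercises (1)(b), (3)(a)] -/
theorem divisorClasses_prinPeriod_blockDiagPoint_eq_hodgeClasses_of_coe_eq_range (hg₁ : 0 < g₁) (hg₂ : 0 < g₂)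
    (h₁ : (hodgeGroup (prinPeriod Z₁) : Set (SpecialLinearGroup (Fin g₁ ⊕ Fin g₁) ℝ)) = Set.range (hodgeCircleSL (prinPeriod Z₁)))
    (h₂ : (hodgeGroup (prinPeriod Z₂) : Set (SpecialLinearGroup (Fin g₂ ⊕ Fin g₂) ℝ)) = Set.range (hodgeCircleSL (prinPeriod Z₂)))
    (p : ℕ) :
    divisorClasses (prinPeriod (blockDiagPoint e Z₁ Z₂) : (Fin g ⊕ Fin g → ℝ) ≃L[ℝ] (Fin g → ℂ)) p =
      hodgeClasses (prinPeriod (blockDiagPoint e Z₁ Z₂)) p :=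
  ((isIsogenous_prinPeriod_blockDiagPoint_prod e Z₁ Z₂).divisorClasses_eq_hodgeClasses_iff _ _ p).2
    (divisorClasses_prodPeriod_eq_hodgeClasses_of_coe_eq_range_of_coe_eq_range _ _ (finrank_fin_fun_complex_pos₆ hg₁)
      (finrank_fin_fun_complex_pos₆ hg₂) h₁ h₂ p)

/-- **… on `𝔥_{g₁}(K₁) × 𝔥_{g₂}(K₂)`: `D^p(X_{(Z₁ 0; 0 Z₂)}) = H^{2p}_Hodge` for every `p`, WHATEVER the two imaginary quadratic
fields** — every Hodge class of `X_{(Z₁ 0; 0 Z₂)}` is a rational polynomial in divisor classes.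
[cite: MoonenZarhin1999LowDim, §3 Corollary (p0007 L80–L85)] [cite: Lange2023AbelianVarietiesComplex, §2.6.3 Exercise (2) and §7.3.3 Exercise (3)(a)] -/
theorem divisorClasses_prinPeriod_blockDiagPoint_eq_hodgeClasses_of_mem_siegelPointsIn (hg₁ : 0 < g₁) (hg₂ : 0 < g₂)
    {K₁ K₂ : IntermediateField ℚ ℂ} (hK₁ : finrank ℚ K₁ = 2) (hK₂ : finrank ℚ K₂ = 2)
    (hZ₁ : Z₁ ∈ siegelPointsIn (K₁ : Set ℂ)) (hZ₂ : Z₂ ∈ siegelPointsIn (K₂ : Set ℂ)) (p : ℕ) :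
    divisorClasses (prinPeriod (blockDiagPoint e Z₁ Z₂) : (Fin g ⊕ Fin g → ℝ) ≃L[ℝ] (Fin g → ℂ)) p =
      hodgeClasses (prinPeriod (blockDiagPoint e Z₁ Z₂)) p :=
  divisorClasses_prinPeriod_blockDiagPoint_eq_hodgeClasses_of_coe_eq_range e hg₁ hg₂
    (coe_hodgeGroup_prinPeriod_eq_range_of_mem_siegelPointsIn hg₁ hK₁ hZ₁)
    (coe_hodgeGroup_prinPeriod_eq_range_of_mem_siegelPointsIn hg₂ hK₂ hZ₂) p

/-- **… and `D^p = H^{2p}_Hodge` on every `X_{Z₁}^{n₁} × X_{Z₂}^{n₂}`** (`n₁, n₂ ≥ 1`) on `𝔥_{g₁}(K₁) × 𝔥_{g₂}(K₂)` — condition (D)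
for these products. [cite: MoonenZarhin1999LowDim, §1 (D) (p0004 L58–L66) and §3 Theorem (p0006 L70–L77)] -/
theorem divisorClasses_prodPeriod_powPeriod_prinPeriod_eq_hodgeClasses_of_mem_siegelPointsIn (hg₁ : 0 < g₁) (hg₂ : 0 < g₂)
    {K₁ K₂ : IntermediateField ℚ ℂ} (hK₁ : finrank ℚ K₁ = 2) (hK₂ : finrank ℚ K₂ = 2)
    (hZ₁ : Z₁ ∈ siegelPointsIn (K₁ : Set ℂ)) (hZ₂ : Z₂ ∈ siegelPointsIn (K₂ : Set ℂ)) {n₁ n₂ : ℕ} (hn₁ : 0 < n₁)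
    (hn₂ : 0 < n₂) (p : ℕ) :
    divisorClasses (prodPeriod (powPeriod (prinPeriod Z₁ : (Fin g₁ ⊕ Fin g₁ → ℝ) ≃L[ℝ] (Fin g₁ → ℂ)) n₁)
        (powPeriod (prinPeriod Z₂ : (Fin g₂ ⊕ Fin g₂ → ℝ) ≃L[ℝ] (Fin g₂ → ℂ)) n₂)) p =
      hodgeClasses (prodPeriod (powPeriod (prinPeriod Z₁) n₁) (powPeriod (prinPeriod Z₂) n₂)) p :=
  divisorClasses_prodPeriod_powPeriod_eq_hodgeClasses_of_coe_eq_range_of_coe_eq_range _ _ (finrank_fin_fun_complex_pos₆ hg₁)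
    (finrank_fin_fun_complex_pos₆ hg₂) (coe_hodgeGroup_prinPeriod_eq_range_of_mem_siegelPointsIn hg₁ hK₁ hZ₁)
    (coe_hodgeGroup_prinPeriod_eq_range_of_mem_siegelPointsIn hg₂ hK₂ hZ₂) hn₁ hn₂ p

end DivisorClasses

/-! ## §2 Picard numbers and `dim H^{2p}_Hodge` on `𝔥_{g₁}(K₁) × 𝔥_{g₂}(K₂)` by the pair of fields -/

section Numbers

variable {g₁ g₂ : ℕ} (e : Fin g₁ ⊕ Fin g₂ ≃ Fin g) {K₁ K₂ : IntermediateField ℚ ℂ}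
  {Z₁ : siegelUpperHalfSpace g₁} {Z₂ : siegelUpperHalfSpace g₂}

/-- `ρ(X_Z) = g²` on `𝔥_g(K)`. [cite: Lange2023AbelianVarietiesComplex, §2.6.3 Exercise (2) (iii) ⟹ (i)] [cite: Beauville2014MaximalPicard, §3 Prop. 3] -/
theorem finrank_neronSeveriGroup_prinPeriod_of_mem_siegelPointsIn (hg : 0 < g) {K : IntermediateField ℚ ℂ}
    (hK : finrank ℚ K = 2) {Z : siegelUpperHalfSpace g} (hZ : Z ∈ siegelPointsIn (K : Set ℂ)) :
    finrank ℤ (neronSeveriGroup (prinPeriod Z : (Fin g ⊕ Fin g → ℝ) ≃L[ℝ] (Fin g → ℂ))) = g ^ 2 := by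
  have h := finrank_neronSeveriGroup_eq_sq_of_coe_hodgeGroup_eq_range (finrank_fin_fun_complex_pos₆ hg)
    (coe_hodgeGroup_prinPeriod_eq_range_of_mem_siegelPointsIn hg hK hZ)
  rwa [finrank_fin_fun_complex₆] at h

/-- **`rk Hom(X_{Z₁}, X_{Z₂}) = 2g₁g₂` FOR EQUAL FIELDS** (Beauville's equality case `rk Hom(A, B) = 2ab`).
[cite: Beauville2014MaximalPicard, §4 Lemma 1 and Prop. 5] -/
theorem finrank_homRat_prinPeriod_of_quadraticField_eq (hg₁ : 0 < g₁) (hg₂ : 0 < g₂) (hK₁ : finrank ℚ K₁ = 2)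
    (hK₂ : finrank ℚ K₂ = 2) (hZ₁ : Z₁ ∈ siegelPointsIn (K₁ : Set ℂ)) (hZ₂ : Z₂ ∈ siegelPointsIn (K₂ : Set ℂ))
    (heq : K₁ = K₂) :
    finrank ℚ (homRat (prinPeriod Z₁ : (Fin g₁ ⊕ Fin g₁ → ℝ) ≃L[ℝ] (Fin g₁ → ℂ))
      (prinPeriod Z₂ : (Fin g₂ ⊕ Fin g₂ → ℝ) ≃L[ℝ] (Fin g₂ → ℂ))) = 2 * g₁ * g₂ := by
  have h := (coe_hodgeGroup_prodPeriod_eq_range_iff_finrank_homRat_eq _ _ (finrank_fin_fun_complex_pos₆ hg₁)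
    (finrank_fin_fun_complex_pos₆ hg₂)).1
    ((coe_hodgeGroup_prodPeriod_prinPeriod_eq_range_iff_quadraticField_eq hg₁ hg₂ hK₁ hK₂ hZ₁ hZ₂).2 heq)
  rwa [finrank_fin_fun_complex₆, finrank_fin_fun_complex₆] at h

/-- **`Hom(X_{Z₁}, X_{Z₂}) = 0` FOR DIFFERENT FIELDS.** [cite: Silverman1994, Ch. II Exercise 2.3] [cite: Lange2023AbelianVarietiesComplex, §2.4.4 Cor. 2.4.26 (proof)] -/
theorem homRat_prinPeriod_eq_bot_of_quadraticField_ne (hg₁ : 0 < g₁) (hg₂ : 0 < g₂) (hK₁ : finrank ℚ K₁ = 2)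
    (hK₂ : finrank ℚ K₂ = 2) (hZ₁ : Z₁ ∈ siegelPointsIn (K₁ : Set ℂ)) (hZ₂ : Z₂ ∈ siegelPointsIn (K₂ : Set ℂ))
    (hne : K₁ ≠ K₂) :
    homRat (prinPeriod Z₁ : (Fin g₁ ⊕ Fin g₁ → ℝ) ≃L[ℝ] (Fin g₁ → ℂ)) (prinPeriod Z₂ : (Fin g₂ ⊕ Fin g₂ → ℝ) ≃L[ℝ] (Fin g₂ → ℂ)) = ⊥ :=
  not_not.1 fun h ↦ hne ((homRat_prinPeriod_ne_bot_iff_quadraticField_eq hg₁ hg₂ hK₁ hK₂ hZ₁ hZ₂).1 h)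

/-- **`rk Hom(X_{Z₁}, X_{Z₂}) = [K₁ = K₂] · 2g₁g₂`** on `𝔥_{g₁}(K₁) × 𝔥_{g₂}(K₂)`. [cite: Beauville2014MaximalPicard, §4 Lemma 1 and Prop. 5]
[cite: Silverman1994, Ch. II Exercise 2.3] -/
theorem finrank_homRat_prinPeriod_eq_ite (hg₁ : 0 < g₁) (hg₂ : 0 < g₂) (hK₁ : finrank ℚ K₁ = 2) (hK₂ : finrank ℚ K₂ = 2)
    (hZ₁ : Z₁ ∈ siegelPointsIn (K₁ : Set ℂ)) (hZ₂ : Z₂ ∈ siegelPointsIn (K₂ : Set ℂ)) :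
    finrank ℚ (homRat (prinPeriod Z₁ : (Fin g₁ ⊕ Fin g₁ → ℝ) ≃L[ℝ] (Fin g₁ → ℂ))
      (prinPeriod Z₂ : (Fin g₂ ⊕ Fin g₂ → ℝ) ≃L[ℝ] (Fin g₂ → ℂ))) = if K₁ = K₂ then 2 * g₁ * g₂ else 0 := by
  split_ifs with heq
  · exact finrank_homRat_prinPeriod_of_quadraticField_eq hg₁ hg₂ hK₁ hK₂ hZ₁ hZ₂ heq
  · rw [homRat_prinPeriod_eq_bot_of_quadraticField_ne hg₁ hg₂ hK₁ hK₂ hZ₁ hZ₂ heq, finrank_bot]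

/-- **`ρ(X_{(Z₁ 0; 0 Z₂)}) = g₁² + g₂²` FOR DIFFERENT FIELDS** (Hulek–Laface: additive when `Hom = 0`).
[cite: HulekLaface2019PicardNumbersAV, §2.1 Cor. 2.3] [cite: Beauville2014MaximalPicard, §3 Prop. 3] -/
theorem finrank_neronSeveriGroup_prinPeriod_blockDiagPoint_of_quadraticField_ne (hg₁ : 0 < g₁) (hg₂ : 0 < g₂)
    (hK₁ : finrank ℚ K₁ = 2) (hK₂ : finrank ℚ K₂ = 2) (hZ₁ : Z₁ ∈ siegelPointsIn (K₁ : Set ℂ))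
    (hZ₂ : Z₂ ∈ siegelPointsIn (K₂ : Set ℂ)) (hne : K₁ ≠ K₂) :
    finrank ℤ (neronSeveriGroup (prinPeriod (blockDiagPoint e Z₁ Z₂) : (Fin g ⊕ Fin g → ℝ) ≃L[ℝ] (Fin g → ℂ))) =
      g₁ ^ 2 + g₂ ^ 2 := by
  rw [finrank_neronSeveriGroup_prinPeriod_blockDiagPoint_of_homRat_eq_bot' e Z₁ Z₂
    (homRat_prinPeriod_eq_bot_of_quadraticField_ne hg₁ hg₂ hK₁ hK₂ hZ₁ hZ₂ hne),
    finrank_neronSeveriGroup_prinPeriod_of_mem_siegelPointsIn hg₁ hK₁ hZ₁,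
    finrank_neronSeveriGroup_prinPeriod_of_mem_siegelPointsIn hg₂ hK₂ hZ₂]

/-- **`ρ(X_{(Z₁ 0; 0 Z₂)}) = (g₁ + g₂)²` FOR EQUAL FIELDS** (`= g₁² + g₂² + 2g₁g₂`, maximal Picard number).
[cite: HulekLaface2019PicardNumbersAV, §2.1 Prop. 2.2] [cite: Beauville2014MaximalPicard, §4 Prop. 5 and Lemma 1] -/
theorem finrank_neronSeveriGroup_prinPeriod_blockDiagPoint_of_quadraticField_eq (hg₁ : 0 < g₁) (hg₂ : 0 < g₂)
    (hK₁ : finrank ℚ K₁ = 2) (hK₂ : finrank ℚ K₂ = 2) (hZ₁ : Z₁ ∈ siegelPointsIn (K₁ : Set ℂ))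
    (hZ₂ : Z₂ ∈ siegelPointsIn (K₂ : Set ℂ)) (heq : K₁ = K₂) :
    finrank ℤ (neronSeveriGroup (prinPeriod (blockDiagPoint e Z₁ Z₂) : (Fin g ⊕ Fin g → ℝ) ≃L[ℝ] (Fin g → ℂ))) =
      (g₁ + g₂) ^ 2 := by
  rw [finrank_neronSeveriGroup_prinPeriod_blockDiagPoint' e Z₁ Z₂,
    finrank_homRat_prinPeriod_of_quadraticField_eq hg₁ hg₂ hK₁ hK₂ hZ₁ hZ₂ heq,
    finrank_neronSeveriGroup_prinPeriod_of_mem_siegelPointsIn hg₁ hK₁ hZ₁,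
    finrank_neronSeveriGroup_prinPeriod_of_mem_siegelPointsIn hg₂ hK₂ hZ₂]
  ring

/-- **`ρ(X_{(Z₁ 0; 0 Z₂)}) = g₁² + g₂² + [K₁ = K₂] · 2g₁g₂`** — the Picard number on `𝔥_{g₁}(K₁) × 𝔥_{g₂}(K₂)` is decided by the
pair of fields. [cite: HulekLaface2019PicardNumbersAV, §2.1 Prop. 2.2 and Cor. 2.3] [cite: Beauville2014MaximalPicard, §4 Prop. 5 and Lemma 1] -/
theorem finrank_neronSeveriGroup_prinPeriod_blockDiagPoint_eq_ite (hg₁ : 0 < g₁) (hg₂ : 0 < g₂) (hK₁ : finrank ℚ K₁ = 2)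
    (hK₂ : finrank ℚ K₂ = 2) (hZ₁ : Z₁ ∈ siegelPointsIn (K₁ : Set ℂ)) (hZ₂ : Z₂ ∈ siegelPointsIn (K₂ : Set ℂ)) :
    finrank ℤ (neronSeveriGroup (prinPeriod (blockDiagPoint e Z₁ Z₂) : (Fin g ⊕ Fin g → ℝ) ≃L[ℝ] (Fin g → ℂ))) =
      g₁ ^ 2 + g₂ ^ 2 + if K₁ = K₂ then 2 * g₁ * g₂ else 0 := by
  split_ifs with heq
  · rw [finrank_neronSeveriGroup_prinPeriod_blockDiagPoint_of_quadraticField_eq e hg₁ hg₂ hK₁ hK₂ hZ₁ hZ₂ heq]; ring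
  · rw [finrank_neronSeveriGroup_prinPeriod_blockDiagPoint_of_quadraticField_ne e hg₁ hg₂ hK₁ hK₂ hZ₁ hZ₂ heq, Nat.add_zero]

/-- **`dim_ℚ H^{2p}_Hodge(X_{(Z₁ 0; 0 Z₂)}) = Σ_{a+b=p} C(g₁,a)² · C(g₂,b)²` FOR DIFFERENT FIELDS** (the Künneth count: no
exceptional classes). [cite: MoonenZarhin1999LowDim, §3 (3.1) (p0006 L53–L62)] [cite: Lange2023AbelianVarietiesComplex, §7.3.3 Exercises (1)(a), (3)(b)] -/
theorem finrank_hodgeClasses_prinPeriod_blockDiagPoint_of_quadraticField_ne (hg₁ : 0 < g₁) (hg₂ : 0 < g₂)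
    (hK₁ : finrank ℚ K₁ = 2) (hK₂ : finrank ℚ K₂ = 2) (hZ₁ : Z₁ ∈ siegelPointsIn (K₁ : Set ℂ))
    (hZ₂ : Z₂ ∈ siegelPointsIn (K₂ : Set ℂ)) (hne : K₁ ≠ K₂) (p : ℕ) :
    finrank ℚ (hodgeClasses (prinPeriod (blockDiagPoint e Z₁ Z₂) : (Fin g ⊕ Fin g → ℝ) ≃L[ℝ] (Fin g → ℂ)) p) =
      ∑ ab ∈ antidiagonal p, (g₁.choose ab.1) ^ 2 * (g₂.choose ab.2) ^ 2 := by
  rw [(isIsogenous_prinPeriod_blockDiagPoint_prod e Z₁ Z₂).finrank_hodgeClasses_eq _ _ p,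
    finrank_hodgeClasses_prodPeriod_eq_sum_of_homRat_eq_bot _ _ (finrank_fin_fun_complex_pos₆ hg₁)
      (finrank_fin_fun_complex_pos₆ hg₂) (coe_hodgeGroup_prinPeriod_eq_range_of_mem_siegelPointsIn hg₁ hK₁ hZ₁)
      (coe_hodgeGroup_prinPeriod_eq_range_of_mem_siegelPointsIn hg₂ hK₂ hZ₂)
      (homRat_prinPeriod_eq_bot_of_quadraticField_ne hg₁ hg₂ hK₁ hK₂ hZ₁ hZ₂ hne) p,
    finrank_fin_fun_complex₆, finrank_fin_fun_complex₆]

/-- **`dim_ℚ H^{2p}_Hodge(X_{(Z₁ 0; 0 Z₂)}) = C(g₁+g₂, p)²` FOR EQUAL FIELDS** (the point is on the Hodge-circle locus of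
`𝔥_{g₁+g₂}`). [cite: Lange2023AbelianVarietiesComplex, §7.3.3 Exercise (3)(b) (p. 342)] [cite: Beauville2014MaximalPicard, §4 Prop. 5] -/
theorem finrank_hodgeClasses_prinPeriod_blockDiagPoint_of_quadraticField_eq (hg₁ : 0 < g₁) (hg₂ : 0 < g₂)
    (hK₁ : finrank ℚ K₁ = 2) (hK₂ : finrank ℚ K₂ = 2) (hZ₁ : Z₁ ∈ siegelPointsIn (K₁ : Set ℂ))
    (hZ₂ : Z₂ ∈ siegelPointsIn (K₂ : Set ℂ)) (heq : K₁ = K₂) (p : ℕ) :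
    finrank ℚ (hodgeClasses (prinPeriod (blockDiagPoint e Z₁ Z₂) : (Fin g ⊕ Fin g → ℝ) ≃L[ℝ] (Fin g → ℂ)) p) =
      ((g₁ + g₂).choose p) ^ 2 := by
  have hg : g = g₁ + g₂ := by simpa using (Fintype.card_congr e).symm
  have h := finrank_hodgeClasses_eq_choose_sq_of_coe_hodgeGroup_eq_range_of_pos
    (prinPeriod (blockDiagPoint e Z₁ Z₂) : (Fin g ⊕ Fin g → ℝ) ≃L[ℝ] (Fin g → ℂ)) (finrank_fin_fun_complex_pos₆ (by omega))
    ((coe_hodgeGroup_prinPeriod_blockDiagPoint_eq_range_iff_quadraticField_eq e hg₁ hg₂ hK₁ hK₂ hZ₁ hZ₂).2 heq) p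
  rw [finrank_fin_fun_complex₆] at h
  rw [h, ← hg]

/-- … `p = 1`: `dim_ℚ H²_Hodge(X_{(Z₁ 0; 0 Z₂)}) = g₁² + g₂²` for different fields (the `H²` form of the Picard number).
[cite: HulekLaface2019PicardNumbersAV, §2.1 Cor. 2.3] -/
theorem finrank_hodgeClasses_one_prinPeriod_blockDiagPoint_of_quadraticField_ne (hg₁ : 0 < g₁) (hg₂ : 0 < g₂)
    (hK₁ : finrank ℚ K₁ = 2) (hK₂ : finrank ℚ K₂ = 2) (hZ₁ : Z₁ ∈ siegelPointsIn (K₁ : Set ℂ))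
    (hZ₂ : Z₂ ∈ siegelPointsIn (K₂ : Set ℂ)) (hne : K₁ ≠ K₂) :
    finrank ℚ (hodgeClasses (prinPeriod (blockDiagPoint e Z₁ Z₂) : (Fin g ⊕ Fin g → ℝ) ≃L[ℝ] (Fin g → ℂ)) 1) =
      g₁ ^ 2 + g₂ ^ 2 := by
  rw [← finrank_neronSeveriGroup_eq_finrank_hodgeClasses,
    finrank_neronSeveriGroup_prinPeriod_blockDiagPoint_of_quadraticField_ne e hg₁ hg₂ hK₁ hK₂ hZ₁ hZ₂ hne]

end Numbers

/-! ## §3 The Hodge ring of `X_{Z₁}^N × X_{Z₂}^N`: generated by the factors iff `K₁ ≠ K₂` -/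

section Ring

variable {g₁ g₂ : ℕ} {K₁ K₂ : IntermediateField ℚ ℂ} {Z₁ : siegelUpperHalfSpace g₁} {Z₂ : siegelUpperHalfSpace g₂}

/-- **THE HODGE CLASSES OF EVERY `X_{Z₁}^N × X_{Z₂}^N` (`N ≥ 1`) ARE GENERATED BY THE CLASSES COMING FROM `X_{Z₁}^N` AND
`X_{Z₂}^N` ⟺ `K₁ ≠ K₂`** — Moonen–Zarhin (3.1) «iff» on `𝔥_{g₁}(K₁) × 𝔥_{g₂}(K₂)` (g32-#6 with `Hom = 0` ⟺ `K₁ ≠ K₂`).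
[cite: MoonenZarhin1999LowDim, §3 (3.1) (p0006 L53–L62) and Theorem (1)] [cite: Imai1976HodgeGroups, §2 Proposition and §3 (ii)] -/
theorem forall_hodgeClasses_prodPeriod_powPeriod_prinPeriod_eq_crossSpan_iff_quadraticField_ne (hg₁ : 0 < g₁) (hg₂ : 0 < g₂)
    (hK₁ : finrank ℚ K₁ = 2) (hK₂ : finrank ℚ K₂ = 2) (hZ₁ : Z₁ ∈ siegelPointsIn (K₁ : Set ℂ))
    (hZ₂ : Z₂ ∈ siegelPointsIn (K₂ : Set ℂ)) :
    (∀ (N p : ℕ), 0 < N →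
      hodgeClasses (prodPeriod (powPeriod (prinPeriod Z₁ : (Fin g₁ ⊕ Fin g₁ → ℝ) ≃L[ℝ] (Fin g₁ → ℂ)) N)
        (powPeriod (prinPeriod Z₂ : (Fin g₂ ⊕ Fin g₂ → ℝ) ≃L[ℝ] (Fin g₂ → ℂ)) N)) p =
        crossSpan (prinPeriod Z₁) (prinPeriod Z₂) N p) ↔ K₁ ≠ K₂ := by
  rw [forall_hodgeClasses_prodPeriod_powPeriod_eq_crossSpan_iff_homRat_eq_bot _ _ (finrank_fin_fun_complex_pos₆ hg₁)
    (finrank_fin_fun_complex_pos₆ hg₂) (coe_hodgeGroup_prinPeriod_eq_range_of_mem_siegelPointsIn hg₁ hK₁ hZ₁)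
    (coe_hodgeGroup_prinPeriod_eq_range_of_mem_siegelPointsIn hg₂ hK₂ hZ₂), Ne,
    ← homRat_prinPeriod_ne_bot_iff_quadraticField_eq hg₁ hg₂ hK₁ hK₂ hZ₁ hZ₂, not_not]

/-- **… SOME `X_{Z₁}^N × X_{Z₂}^N` CARRIES AN EXCEPTIONAL HODGE CLASS ⟺ `K₁ = K₂`.**
[cite: MoonenZarhin1999LowDim, §3 (3.1) (p0006 L53–L62)] [cite: Imai1976HodgeGroups, §3 Remarks (p. 370)] -/
theorem exists_hodgeClasses_prodPeriod_powPeriod_prinPeriod_ne_crossSpan_iff_quadraticField_eq (hg₁ : 0 < g₁) (hg₂ : 0 < g₂)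
    (hK₁ : finrank ℚ K₁ = 2) (hK₂ : finrank ℚ K₂ = 2) (hZ₁ : Z₁ ∈ siegelPointsIn (K₁ : Set ℂ))
    (hZ₂ : Z₂ ∈ siegelPointsIn (K₂ : Set ℂ)) :
    (∃ (N p : ℕ), 0 < N ∧
      hodgeClasses (prodPeriod (powPeriod (prinPeriod Z₁ : (Fin g₁ ⊕ Fin g₁ → ℝ) ≃L[ℝ] (Fin g₁ → ℂ)) N)
        (powPeriod (prinPeriod Z₂ : (Fin g₂ ⊕ Fin g₂ → ℝ) ≃L[ℝ] (Fin g₂ → ℂ)) N)) p ≠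
        crossSpan (prinPeriod Z₁) (prinPeriod Z₂) N p) ↔ K₁ = K₂ := by
  rw [exists_hodgeClasses_prodPeriod_powPeriod_ne_crossSpan_iff_homRat_ne_bot _ _ (finrank_fin_fun_complex_pos₆ hg₁)
    (finrank_fin_fun_complex_pos₆ hg₂) (coe_hodgeGroup_prinPeriod_eq_range_of_mem_siegelPointsIn hg₁ hK₁ hZ₁)
    (coe_hodgeGroup_prinPeriod_eq_range_of_mem_siegelPointsIn hg₂ hK₂ hZ₂),
    homRat_prinPeriod_ne_bot_iff_quadraticField_eq hg₁ hg₂ hK₁ hK₂ hZ₁ hZ₂]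

/-- For different fields, explicitly: `H^{2p}_Hodge(X_{Z₁}^N × X_{Z₂}^N) = crossSpan` for every `N ≥ 1`.
[cite: MoonenZarhin1999LowDim, §3 (3.1) and Corollary] -/
theorem hodgeClasses_prodPeriod_powPeriod_prinPeriod_eq_crossSpan_of_quadraticField_ne (hg₁ : 0 < g₁) (hg₂ : 0 < g₂)
    (hK₁ : finrank ℚ K₁ = 2) (hK₂ : finrank ℚ K₂ = 2) (hZ₁ : Z₁ ∈ siegelPointsIn (K₁ : Set ℂ))
    (hZ₂ : Z₂ ∈ siegelPointsIn (K₂ : Set ℂ)) (hne : K₁ ≠ K₂) {N : ℕ} (hN : 0 < N) (p : ℕ) :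
    hodgeClasses (prodPeriod (powPeriod (prinPeriod Z₁ : (Fin g₁ ⊕ Fin g₁ → ℝ) ≃L[ℝ] (Fin g₁ → ℂ)) N)
        (powPeriod (prinPeriod Z₂ : (Fin g₂ ⊕ Fin g₂ → ℝ) ≃L[ℝ] (Fin g₂ → ℂ)) N)) p =
      crossSpan (prinPeriod Z₁) (prinPeriod Z₂) N p :=
  (forall_hodgeClasses_prodPeriod_powPeriod_prinPeriod_eq_crossSpan_iff_quadraticField_ne hg₁ hg₂ hK₁ hK₂ hZ₁ hZ₂).2 hne N p hN

end Ring

/-! ## §4 `𝔥₁ × 𝔥₁`: the Picard number of `E_{τ₁} × E_{τ₂}` for CM points by fields -/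

section DegreeOne

variable (e : Fin 1 ⊕ Fin 1 ≃ Fin 2) {K₁ K₂ : IntermediateField ℚ ℂ} {Z₁ Z₂ : siegelUpperHalfSpace 1}

/-- **`ρ(X_{(τ₁ 0; 0 τ₂)}) = 2` for CM points in DIFFERENT fields, `= 4` for CM points in the SAME field** — the field form of
«`ρ = 2, 3 or 4` — non-isogenous, isogenous without CM, isogenous with CM» (the value `3` needs non-CM curves and does not
occur on `𝔥₁(K₁) × 𝔥₁(K₂)`). [cite: HulekLaface2019PicardNumbersAV, §1 and §2.1 Prop. 2.2] [cite: Beauville2014MaximalPicard, §4 Prop. 5]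
[cite: Imai1976HodgeGroups, §3 (ii) (p. 371)] -/
theorem finrank_neronSeveriGroup_prinPeriod_blockDiagPoint_one_one_eq_ite (hK₁ : finrank ℚ K₁ = 2) (hK₂ : finrank ℚ K₂ = 2)
    (hZ₁ : Z₁ ∈ siegelPointsIn (K₁ : Set ℂ)) (hZ₂ : Z₂ ∈ siegelPointsIn (K₂ : Set ℂ)) :
    finrank ℤ (neronSeveriGroup (prinPeriod (blockDiagPoint e Z₁ Z₂) : (Fin 2 ⊕ Fin 2 → ℝ) ≃L[ℝ] (Fin 2 → ℂ))) =
      if K₁ = K₂ then 4 else 2 := by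
  rw [finrank_neronSeveriGroup_prinPeriod_blockDiagPoint_eq_ite e one_pos one_pos hK₁ hK₂ hZ₁ hZ₂]
  split_ifs <;> norm_num

/-- `ρ(X_{(τ₁ 0; 0 τ₂)}) = 2` for CM points in different fields. [cite: HulekLaface2019PicardNumbersAV, §2.1 Cor. 2.3] -/
theorem finrank_neronSeveriGroup_prinPeriod_blockDiagPoint_one_one_of_quadraticField_ne (hK₁ : finrank ℚ K₁ = 2)
    (hK₂ : finrank ℚ K₂ = 2) (hZ₁ : Z₁ ∈ siegelPointsIn (K₁ : Set ℂ)) (hZ₂ : Z₂ ∈ siegelPointsIn (K₂ : Set ℂ))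
    (hne : K₁ ≠ K₂) :
    finrank ℤ (neronSeveriGroup (prinPeriod (blockDiagPoint e Z₁ Z₂) : (Fin 2 ⊕ Fin 2 → ℝ) ≃L[ℝ] (Fin 2 → ℂ))) = 2 := by
  rw [finrank_neronSeveriGroup_prinPeriod_blockDiagPoint_one_one_eq_ite e hK₁ hK₂ hZ₁ hZ₂, if_neg hne]

/-- `ρ(X_{(τ₁ 0; 0 τ₂)}) = 4` for CM points in the same field. [cite: Beauville2014MaximalPicard, §4 Prop. 5]
[cite: Lange2023AbelianVarietiesComplex, §2.6.3 Exercise (2) (i) ⟺ (iv)] -/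
theorem finrank_neronSeveriGroup_prinPeriod_blockDiagPoint_one_one_of_quadraticField_eq (hK₁ : finrank ℚ K₁ = 2)
    (hK₂ : finrank ℚ K₂ = 2) (hZ₁ : Z₁ ∈ siegelPointsIn (K₁ : Set ℂ)) (hZ₂ : Z₂ ∈ siegelPointsIn (K₂ : Set ℂ))
    (heq : K₁ = K₂) :
    finrank ℤ (neronSeveriGroup (prinPeriod (blockDiagPoint e Z₁ Z₂) : (Fin 2 ⊕ Fin 2 → ℝ) ≃L[ℝ] (Fin 2 → ℂ))) = 4 := by
  rw [finrank_neronSeveriGroup_prinPeriod_blockDiagPoint_one_one_eq_ite e hK₁ hK₂ hZ₁ hZ₂, if_pos heq]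

end DegreeOne

end SiegelModuli

end Literature.AlgebraicGeometry.ModuliOfAbelianVarieties
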